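import Summits.ResolutionOfSingularities.ResolutionOfSingularities.Theorems.HilbertSamuelEliminationSigmaMaxModificationsCorridor3WLadderRecognitionNearLocusWShape
import Summits.ResolutionOfSingularities.ResolutionOfSingularities.Theorems.HilbertSamuelEliminationSigmaMaxModificationsCorridor3WLadderRecognitionNearLocusKeys
import Literature.AlgebraicGeometry.CossartJannsenSaito2020.ProjDirProjectiveLineRegular
import HarnessLib

/-!
# [OURS · L1 W4.2] RECOGNITION-GEOMETRY (R2), WAITING-TOLERANT FORM WITH A PARAMETRIC POINT HYPOTHESIS `F`, PART 4: the first stage `N_1(x) = ℙ(Dir_x)`, the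
# unit-level `iso` / (Dich⁺) / `not_surjective` clauses from the data of CJS Def. 6.38 (ii)–(iii)
# (crux chain w42, line `w_ladder`; `--supports stmt-…-19249`, helper)

OURS (cell res-hironaka, slot W4.2, seat res-L1-w42-stub-2 gen 4); NOT statements of H. Hironaka's manuscript [Hironaka2017]
nor of [CossartJannsenSaito2020]. AI-drafted, weaker than expert review. Sorry-free PROOF file (no new definition).

`…WLadderRecognitionNearLocusUnit` RE-ISSUED with the point hypothesis `F` as a parameter and stage-`j`-only hypotheses (see PART 1
`…WFibres`); the additional
section variable `h314pt` is the point-centre LOCUS form of CJS Thm. 3.14 keyed on `F` (the shape of `Thm314_point_locus` /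
`Thm314_point_locus_geomDir`). P-a enters PROVED (`ProjDir_projLine_holds`, res-type-031). Namespace `BlowupTowerNearW`:
`nearLocus_one_subset_projDir`, `nearLocus_one_eq_projDir`, `centres_eq_nearLocus_of_unit`, `exists_not_isClosed_singleton_of_dominant`,
**`dichPlus_nearLocus_succ`**, **`inducesIsoOn_of_unit`** (CJS Def. 6.38 (iv) for all `1 ≤ j`, `j + 1 ≤ q`), **`dichPlus_of_unit`**,
**`not_surjective_of_unit`** (Def. 6.38 (v)).

## References

* V. Cossart, U. Jannsen, S. Saito, LNM 2270 (2020): Thm. 3.3, Thm. 3.14, Def. 6.34 (i), Def. 6.38 (ii)–(v), p. 94, pp. 103–105.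
  [CossartJannsenSaito2020]
-/

noncomputable section

-- namespace `…Corridor3.Helpers` re-enters `…Corridor3`
set_option linter.dupNamespace false

open CategoryTheory AlgebraicGeometry TopologicalSpace IsLocalRing
open Literature.AlgebraicGeometry.Resolution
open Scheme.IdealSheafData

universe u

open Literature.AlgebraicGeometry.CossartJannsenSaito2020

namespace Summit.ResolutionOfSingularities.ResolutionOfSingularities.Theorems.SigmaMaxModificationsCorridor3.Helpers

namespace BlowupTowerNearW

/-! Section variables (first explicit arguments of every theorem, in this order where included): `F`, `h314f`, `hPb`, `h314`,
`h314pt`. -/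

variable {T : BlowupTower.{u}} {N : ℕ}
  (F : ∀ (X : Scheme.{u}) [IsLocallyNoetherian X], X → Prop)
  (h314f : ∀ (X X' : Scheme.{u}) [IsLocallyNoetherian X] (π : X' ⟶ X) (D : X.IdealSheafData),
    Scheme.IsExcellent X → IdealSheafData.IsPermissible D → IsBlowup π D →
      ∀ N : ℕ, topologicalKrullDim X ≤ (N : WithBot ℕ∞) →
        ∀ x : X, x ∈ D.support → F X x →
          (Scheme.dirDim X x : WithBot ℕ∞) ≤ ringKrullDim (X.presheaf.stalk x ⧸ stalkIdeal D x) + 1 →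
            {x' : X' | π.base x' = x ∧ Scheme.hsFun X' N x' = Scheme.hsFun X N x}.Subsingleton)
  (hPb : ∀ (X X' : Scheme.{u}) [IsLocallyNoetherian X] [IsLocallyNoetherian X'] (π : X' ⟶ X) (D : X.IdealSheafData),
    Scheme.IsExcellent X → IdealSheafData.IsPermissible D → IsBlowup π D →
      ∀ N : ℕ, topologicalKrullDim ↥X ≤ (N : WithBot ℕ∞) →
        ∀ x' : X', π.base x' ∈ D.support → stalkIdeal D (π.base x') = maximalIdeal _ →
          F X (π.base x') → Scheme.dirDim X (π.base x') = 1 →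
            Scheme.hsFun X' N x' = Scheme.hsFun X N (π.base x') → IsIso (π.residueFieldMap x'))
  (h314 : ∀ (X X' : Scheme.{u}) [IsLocallyNoetherian X] [IsLocallyNoetherian X'] (π : X' ⟶ X) (D : X.IdealSheafData),
    Scheme.IsExcellent X → IdealSheafData.IsPermissible D → IsBlowup π D →
      ∀ N : ℕ, topologicalKrullDim X ≤ (N : WithBot ℕ∞) →
        ∀ x' : X', π.base x' ∈ D.support → F X (π.base x') →
          Scheme.hsFun X' N x' = Scheme.hsFun X N (π.base x') →
            ringKrullDim (X.presheaf.stalk (π.base x') ⧸ stalkIdeal D (π.base x')) <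
              (Scheme.dirDim X (π.base x') : WithBot ℕ∞))
  (h314pt : ∀ (X X' : Scheme.{u}) [IsLocallyNoetherian X] (π : X' ⟶ X) (x : X) (hx : IsClosed ({x} : Set X)) (N : ℕ)
    (x' : X'), Scheme.IsExcellent X → IdealSheafData.IsPermissible (vanishingIdeal ⟨{x}, hx⟩) →
      IsBlowup π (vanishingIdeal ⟨{x}, hx⟩) → topologicalKrullDim ↥X ≤ (N : WithBot ℕ∞) → π.base x' = x → F X x →
        Scheme.hsFun X' N x' = Scheme.hsFun X N x → IsOnProjDirectrix π x')

/-! ## The first stage -/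

section First

include h314pt

/-- **`N_1(x) ⊆ ℙ(Dir_x(X_0))`**: every point of `X_1` near to `x` lies on the projectivised directrix (CJS Thm. 3.14 for the point
centre `{x}`, locus form keyed on `F`). [cite: CossartJannsenSaito2020, Thm. 3.14, p. 103] -/
theorem nearLocus_one_subset_projDir (hkey : KeySetting T N) (hperm : ∀ j, IdealSheafData.IsPermissible (T.centreIdeal j))
    {x : T.X 0} (hx : IsClosed ({x} : Set (T.X 0))) (hC0 : T.C 0 = {x})
    (hF : ∀ i, ∀ y ∈ T.nearLocus N x i, @F (T.X i) (T.ln i) y) : T.nearLocus N x 1 ⊆ T.projDir x := by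
  haveI : ∀ j, IsLocallyNoetherian (T.X j) := T.ln
  have hcl : (⟨T.C 0, T.isClosed_C 0⟩ : Closeds (T.X 0)) = ⟨{x}, hx⟩ := Closeds.ext hC0
  have hbl : IsBlowup (T.π 0) (vanishingIdeal (⟨{x}, hx⟩ : Closeds (T.X 0))) := by
    have h := T.isBlowup 0
    rwa [hcl] at h
  have hp : IdealSheafData.IsPermissible (vanishingIdeal (⟨{x}, hx⟩ : Closeds (T.X 0))) := by
    have h := hperm 0
    rwa [BlowupTower.centreIdeal, hcl] at h
  have hFx : F (T.X 0) x := hF 0 x (by rw [BlowupTower.nearLocus_zero]; rfl)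
  intro ξ hξ
  rw [BlowupTower.mem_nearLocus, BlowupTower.phi_one] at hξ
  rw [BlowupTower.mem_projDir]
  exact ⟨hξ.1, h314pt (T.X 0) (T.X 1) (T.π 0) x hx N ξ hkey.excellent hp hbl hkey.dim_le hξ.1 hFx hξ.2⟩

/-- **`N_1(x) = ℙ(Dir_x(X_0))` when `C_1 = ℙ(Dir_x)` is the centre of `π_2` and `N_1(x) ≠ ∅`** (`⊆` by Thm. 3.14; `⊇`: `H` is constant
along the permissible irreducible `C_1`, which contains a near point; P-a `ProjDir_projLine_holds` for irreducibility).
[cite: CossartJannsenSaito2020, Thm. 3.14, Thm. 3.3, Def. 6.38 (ii)–(iii)] -/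
theorem nearLocus_one_eq_projDir (hkey : KeySetting T N) (hperm : ∀ j, IdealSheafData.IsPermissible (T.centreIdeal j))
    {x : T.X 0} (hx : IsClosed ({x} : Set (T.X 0))) (hC0 : T.C 0 = {x})
    (hF : ∀ i, ∀ y ∈ T.nearLocus N x i, @F (T.X i) (T.ln i) y) (he : T.dirDimAt 0 x = 2) (hC1 : T.C 1 = T.projDir x)
    (hN1 : (T.nearLocus N x 1).Nonempty) : T.nearLocus N x 1 = T.projDir x := by
  have hsub := nearLocus_one_subset_projDir F h314pt hkey hperm hx hC0 hF
  refine subset_antisymm hsub ?_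
  obtain ⟨y₀, hy₀⟩ := hN1
  obtain ⟨-, hirr, -, -⟩ := BlowupTowerNear.curveData_projDir ProjDir_projLine_holds hx hC0 he
  rw [← hC1] at hirr ⊢
  refine BlowupTowerNear.centre_subset_nearLocus_of_isPermissible T hkey hperm hirr ?_ (hC1 ▸ hsub hy₀) hy₀.2
  intro z hz
  rw [hC1, BlowupTower.mem_projDir] at hz
  show (T.phi 1).base z = x
  rw [BlowupTower.phi_one]; exact hz.1

/-- The centres ARE the near loci at all stages `1 ≤ i ≤ q` once `C_1 = ℙ(Dir_x)` (with `N_1(x) ≠ ∅`) and `C_i = N_i(x)` for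
`2 ≤ i ≤ q`. [cite: CossartJannsenSaito2020, Def. 6.38 (ii)–(iii)] -/
theorem centres_eq_nearLocus_of_unit (hkey : KeySetting T N) (hperm : ∀ j, IdealSheafData.IsPermissible (T.centreIdeal j))
    {x : T.X 0} (hx : IsClosed ({x} : Set (T.X 0))) (hC0 : T.C 0 = {x})
    (hF : ∀ i, ∀ y ∈ T.nearLocus N x i, @F (T.X i) (T.ln i) y) (he : T.dirDimAt 0 x = 2) (hC1 : T.C 1 = T.projDir x)
    (hN1 : (T.nearLocus N x 1).Nonempty) {q : ℕ} (hCq : ∀ i, 2 ≤ i → i ≤ q → T.C i = T.nearLocus N x i) :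
    ∀ i, 1 ≤ i → i ≤ q → T.C i = T.nearLocus N x i := by
  intro i hi hiq
  rcases Nat.lt_or_ge i 2 with h | h
  · obtain rfl : i = 1 := by omega
    rw [hC1, nearLocus_one_eq_projDir F h314pt hkey hperm hx hC0 hF he hC1 hN1]
  · exact hCq i h hiq

end First

/-! ## (Dich⁺) at one step -/

section Dich

include h314f

/-- **In the dominant case the generic point of `N_{j+1}(x)` is NOT a closed point.** [cite: CossartJannsenSaito2020, p. 104] -/
theorem exists_not_isClosed_singleton_of_dominant (hT36 : CossartJannsenSaito2020_thm_3_6.{u})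
    (h3104 : CossartJannsenSaito2020_thm_3_10_4.{u}) (hkey : KeySetting T N)
    (hperm : ∀ j, IdealSheafData.IsPermissible (T.centreIdeal j))
    (hcl : ∀ (j : ℕ) (μ : ℕ → ℕ), IsClosed (Scheme.hsStratumGE (T.X j) N μ))
    {x : T.X 0} (hx : IsClosed ({x} : Set (T.X 0)))
    (hF : ∀ i, ∀ y ∈ T.nearLocus N x i, @F (T.X i) (T.ln i) y) (hē : T.geomDirDimAt 0 x ≤ 2) {j : ℕ}
    (hNC : T.nearLocus N x j ⊆ T.C j) (hCN : T.C j ⊆ T.nearLocus N x j)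
    (hirr : IsIrreducible (T.C j)) (hnt : (T.C j).Nontrivial)
    (hpts : ∀ y ∈ T.C j, ¬ IsGenericPoint y (T.C j) → IsClosed ({y} : Set (T.X j)))
    {η : T.X j} (hη : IsGenericPoint η (T.C j)) (hdom : η ∈ (T.π j).base '' T.nearLocus N x (j + 1)) :
    ∃ z ∈ T.nearLocus N x (j + 1), ¬ IsClosed ({z} : Set (T.X (j + 1))) := by
  have hirr' := isIrreducible_nearLocus_succ_of_dominant F h314f hT36 h3104 hkey hperm hcl hx hF hē hNC hCN hirr hnt hpts hη hdom
  have hnt' := nontrivial_nearLocus_succ_of_dominant F h314f hT36 h3104 hkey hperm hcl hx hF hē hNC hCN hirr hnt hpts hη hdom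
  have hζ : IsGenericPoint hirr'.genericPoint (T.nearLocus N x (j + 1)) :=
    hirr'.isGenericPoint_genericPoint (BlowupTowerNear.isClosed_nearLocus T hkey hperm hcl hx (j + 1))
  refine ⟨hirr'.genericPoint, hζ.mem, fun hcl' => ?_⟩
  obtain ⟨w, hw, hne⟩ := hnt'.exists_ne hirr'.genericPoint
  have h1 : closure {hirr'.genericPoint} = T.nearLocus N x (j + 1) := hζ.def
  rw [hcl'.closure_eq] at h1
  exact hne (by rw [← h1] at hw; exact hw)

include hPb h314

/-- **(Dich⁺) at one step**: `N_{j+1}(x)` is EITHER irreducible, nontrivial, with a non-closed point, and regular (reduced structure), OR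
a finite set of closed points (`X_0` noetherian). [cite: CossartJannsenSaito2020, p. 94, p. 104] -/
theorem dichPlus_nearLocus_succ [IsNoetherian (T.X 0)] (hT36 : CossartJannsenSaito2020_thm_3_6.{u})
    (h3104 : CossartJannsenSaito2020_thm_3_10_4.{u}) (hkey : KeySetting T N)
    (hperm : ∀ j, IdealSheafData.IsPermissible (T.centreIdeal j))
    (hcl : ∀ (j : ℕ) (μ : ℕ → ℕ), IsClosed (Scheme.hsStratumGE (T.X j) N μ))
    {x : T.X 0} (hx : IsClosed ({x} : Set (T.X 0)))
    (hF : ∀ i, ∀ y ∈ T.nearLocus N x i, @F (T.X i) (T.ln i) y) (hē : T.geomDirDimAt 0 x ≤ 2) {j : ℕ}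
    (hNC : T.nearLocus N x j ⊆ T.C j) (hCN : T.C j ⊆ T.nearLocus N x j)
    (hirr : IsIrreducible (T.C j)) (hnt : (T.C j).Nontrivial)
    (hpts : ∀ y ∈ T.C j, ¬ IsGenericPoint y (T.C j) → IsClosed ({y} : Set (T.X j))) :
    (IsIrreducible (T.nearLocus N x (j + 1)) ∧ (T.nearLocus N x (j + 1)).Nontrivial ∧
        (∃ z ∈ T.nearLocus N x (j + 1), ¬ IsClosed ({z} : Set (T.X (j + 1)))) ∧
        ∀ hN : IsClosed (T.nearLocus N x (j + 1)),
          Scheme.IsRegular (vanishingIdeal (⟨T.nearLocus N x (j + 1), hN⟩ : Closeds (T.X (j + 1)))).subscheme) ∨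
      ((T.nearLocus N x (j + 1)).Finite ∧ ∀ z ∈ T.nearLocus N x (j + 1), IsClosed ({z} : Set (T.X (j + 1)))) := by
  have hη : IsGenericPoint hirr.genericPoint (T.C j) := hirr.isGenericPoint_genericPoint (T.isClosed_C j)
  by_cases hdom : hirr.genericPoint ∈ (T.π j).base '' T.nearLocus N x (j + 1)
  · exact Or.inl ⟨isIrreducible_nearLocus_succ_of_dominant F h314f hT36 h3104 hkey hperm hcl hx hF hē hNC hCN hirr hnt hpts hη hdom,
      nontrivial_nearLocus_succ_of_dominant F h314f hT36 h3104 hkey hperm hcl hx hF hē hNC hCN hirr hnt hpts hη hdom,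
      exists_not_isClosed_singleton_of_dominant F h314f hT36 h3104 hkey hperm hcl hx hF hē hNC hCN hirr hnt hpts hη hdom,
      fun hN => isRegular_nearLocus_succ_of_dominant F h314f hPb h314 hT36 h3104 hkey hperm hcl hx hF hē hNC hCN hirr hnt hpts hη
        hdom hN⟩
  · exact Or.inr ⟨finite_nearLocus_succ_of_not_dominant F h314f hT36 h3104 hkey hperm hcl hx hF hē hNC hCN hirr hnt hpts hη hdom,
      isClosed_singleton_of_mem_nearLocus_succ_of_not_dominant F h314f hT36 h3104 hkey hperm hcl hx hF hē hNC hCN hirr hnt hpts hη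
        hdom⟩

end Dich

/-! ## The unit-level clauses from the data of CJS Def. 6.38 (ii)–(iii) -/

section Unit

include h314f hPb h314 h314pt

/-- **CJS Def. 6.38 (iv) FROM THE DATA OF (ii)–(iii): `π_{j+1} : C_{j+1} ⥲ C_j` for all `1 ≤ j`, `j + 1 ≤ q`**, for a tower with
`C_0 = {x}` (`x` closed, `e_x = 2`, `ē_x ≤ 2`, `F` along the near loci, closed strata, `X_0` noetherian), `C_1 = ℙ(Dir_x)`, `N_1(x) ≠ ∅`,
`C_i = N_i(x)` (`2 ≤ i ≤ q`) and, at every stage `2 ≤ i ≤ q`, a CLOSED near point NOT isolated in `N_i(x)`. With `q = m − 1` this is the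
`iso` clause of `IsFundamentalUnit` / `Seg.UnitCentreDiscipline`. [cite: CossartJannsenSaito2020, Def. 6.38 (ii)–(iv), p. 104] -/
theorem inducesIsoOn_of_unit [IsNoetherian (T.X 0)] (hT36 : CossartJannsenSaito2020_thm_3_6.{u})
    (h3104 : CossartJannsenSaito2020_thm_3_10_4.{u}) (hkey : KeySetting T N)
    (hperm : ∀ j, IdealSheafData.IsPermissible (T.centreIdeal j))
    (hcl : ∀ (j : ℕ) (μ : ℕ → ℕ), IsClosed (Scheme.hsStratumGE (T.X j) N μ))
    {x : T.X 0} (hx : IsClosed ({x} : Set (T.X 0)))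
    (hF : ∀ i, ∀ y ∈ T.nearLocus N x i, @F (T.X i) (T.ln i) y) (he : T.dirDimAt 0 x = 2) (hē : T.geomDirDimAt 0 x ≤ 2)
    (hC0 : T.C 0 = {x}) (hC1 : T.C 1 = T.projDir x) (hN1 : (T.nearLocus N x 1).Nonempty)
    {q : ℕ} (hCq : ∀ i, 2 ≤ i → i ≤ q → T.C i = T.nearLocus N x i)
    (hniso : ∀ i, 2 ≤ i → i ≤ q → ∃ z ∈ T.nearLocus N x i, IsClosed ({z} : Set (T.X i)) ∧
      ¬ ∃ U : Set (T.X i), IsOpen U ∧ U ∩ T.nearLocus N x i = {z}) :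
    ∀ j, 1 ≤ j → j + 1 ≤ q → InducesIsoOn (T.π j) (T.C (j + 1)) (T.isClosed_C (j + 1)) (T.C j) (T.isClosed_C j) := by
  have hCq' := centres_eq_nearLocus_of_unit F h314pt hkey hperm hx hC0 hF he hC1 hN1 hCq
  obtain ⟨-, h1irr, h1nt, h1pts⟩ := BlowupTowerNear.curveData_projDir ProjDir_projLine_holds hx hC0 he
  rw [← hC1] at h1irr h1nt h1pts
  exact inducesIsoOn_of_centres_eq_nearLocus F h314f hPb h314 hT36 h3104 hkey hperm hcl hx hF hē hC0 hCq' h1irr h1nt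
    (fun y hy hgy => h1pts y hy hgy) hniso

/-- **(Dich⁺) FROM THE DATA OF Def. 6.38 (ii)–(iii)** at every stage `1 ≤ j ≤ q` (hypotheses of `inducesIsoOn_of_unit`).
[cite: CossartJannsenSaito2020, Def. 6.38 (iii)–(iv), p. 94, p. 104] -/
theorem dichPlus_of_unit [IsNoetherian (T.X 0)] (hT36 : CossartJannsenSaito2020_thm_3_6.{u})
    (h3104 : CossartJannsenSaito2020_thm_3_10_4.{u}) (hkey : KeySetting T N)
    (hperm : ∀ j, IdealSheafData.IsPermissible (T.centreIdeal j))
    (hcl : ∀ (j : ℕ) (μ : ℕ → ℕ), IsClosed (Scheme.hsStratumGE (T.X j) N μ))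
    {x : T.X 0} (hx : IsClosed ({x} : Set (T.X 0)))
    (hF : ∀ i, ∀ y ∈ T.nearLocus N x i, @F (T.X i) (T.ln i) y) (he : T.dirDimAt 0 x = 2) (hē : T.geomDirDimAt 0 x ≤ 2)
    (hC0 : T.C 0 = {x}) (hC1 : T.C 1 = T.projDir x) (hN1 : (T.nearLocus N x 1).Nonempty)
    {q : ℕ} (hCq : ∀ i, 2 ≤ i → i ≤ q → T.C i = T.nearLocus N x i)
    (hniso : ∀ i, 2 ≤ i → i ≤ q → ∃ z ∈ T.nearLocus N x i, IsClosed ({z} : Set (T.X i)) ∧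
      ¬ ∃ U : Set (T.X i), IsOpen U ∧ U ∩ T.nearLocus N x i = {z})
    {j : ℕ} (hj : 1 ≤ j) (hjq : j ≤ q) :
    (IsIrreducible (T.nearLocus N x (j + 1)) ∧ (T.nearLocus N x (j + 1)).Nontrivial ∧
        (∃ z ∈ T.nearLocus N x (j + 1), ¬ IsClosed ({z} : Set (T.X (j + 1)))) ∧
        ∀ hN : IsClosed (T.nearLocus N x (j + 1)),
          Scheme.IsRegular (vanishingIdeal (⟨T.nearLocus N x (j + 1), hN⟩ : Closeds (T.X (j + 1)))).subscheme) ∨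
      ((T.nearLocus N x (j + 1)).Finite ∧ ∀ z ∈ T.nearLocus N x (j + 1), IsClosed ({z} : Set (T.X (j + 1)))) := by
  have hCq' := centres_eq_nearLocus_of_unit F h314pt hkey hperm hx hC0 hF he hC1 hN1 hCq
  obtain ⟨-, h1irr, h1nt, h1pts⟩ := BlowupTowerNear.curveData_projDir ProjDir_projLine_holds hx hC0 he
  rw [← hC1] at h1irr h1nt h1pts
  have hNC : T.nearLocus N x j ⊆ T.C j := (hCq' j hj hjq).symm.subset
  obtain ⟨hirr, hnt, hpts⟩ := curveData_of_centres_eq_nearLocus F h314f hT36 h3104 hkey hperm hcl hx hF hē hC0 hCq' h1irr h1nt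
    (fun y hy hgy => h1pts y hy hgy) hniso j hj hjq
  exact dichPlus_nearLocus_succ F h314f hPb h314 hT36 h3104 hkey hperm hcl hx hF hē hNC (hCq' j hj hjq).subset hirr hnt hpts

omit hPb h314 in
/-- **CJS Def. 6.38 (v) FROM THE DATA OF (ii)–(iii)**: `¬ (C_q ⊆ π_{q+1}(N_{q+1}(x)))` if, in addition, some CLOSED point of
`N_{q+1}(x)` is ISOLATED in it (the marked point at the terminal `Iso` stage) — the `not_surjective` clause (`j = q`, `m = q + 1`).
[cite: CossartJannsenSaito2020, Def. 6.38 (v), p. 105] -/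
theorem not_surjective_of_unit [IsNoetherian (T.X 0)] (hT36 : CossartJannsenSaito2020_thm_3_6.{u})
    (h3104 : CossartJannsenSaito2020_thm_3_10_4.{u}) (hkey : KeySetting T N)
    (hperm : ∀ j, IdealSheafData.IsPermissible (T.centreIdeal j))
    (hcl : ∀ (j : ℕ) (μ : ℕ → ℕ), IsClosed (Scheme.hsStratumGE (T.X j) N μ))
    {x : T.X 0} (hx : IsClosed ({x} : Set (T.X 0)))
    (hF : ∀ i, ∀ y ∈ T.nearLocus N x i, @F (T.X i) (T.ln i) y) (he : T.dirDimAt 0 x = 2) (hē : T.geomDirDimAt 0 x ≤ 2)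
    (hC0 : T.C 0 = {x}) (hC1 : T.C 1 = T.projDir x) (hN1 : (T.nearLocus N x 1).Nonempty)
    {q : ℕ} (hq : 1 ≤ q) (hCq : ∀ i, 2 ≤ i → i ≤ q → T.C i = T.nearLocus N x i)
    (hniso : ∀ i, 2 ≤ i → i ≤ q → ∃ z ∈ T.nearLocus N x i, IsClosed ({z} : Set (T.X i)) ∧
      ¬ ∃ U : Set (T.X i), IsOpen U ∧ U ∩ T.nearLocus N x i = {z})
    {z : T.X (q + 1)} (hzcl : IsClosed ({z} : Set (T.X (q + 1))))
    (hiso : ∃ U : Set (T.X (q + 1)), IsOpen U ∧ U ∩ T.nearLocus N x (q + 1) = {z}) :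
    ¬ (T.C q ⊆ (T.π q).base '' T.nearLocus N x (q + 1)) := by
  have hCq' := centres_eq_nearLocus_of_unit F h314pt hkey hperm hx hC0 hF he hC1 hN1 hCq
  obtain ⟨-, h1irr, h1nt, h1pts⟩ := BlowupTowerNear.curveData_projDir ProjDir_projLine_holds hx hC0 he
  rw [← hC1] at h1irr h1nt h1pts
  have hNC : T.nearLocus N x q ⊆ T.C q := (hCq' q hq le_rfl).symm.subset
  obtain ⟨hirr, hnt, hpts⟩ := curveData_of_centres_eq_nearLocus F h314f hT36 h3104 hkey hperm hcl hx hF hē hC0 hCq' h1irr h1nt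
    (fun y hy hgy => h1pts y hy hgy) hniso q hq le_rfl
  exact not_subset_image_nearLocus_succ_of_isolated_closed F h314f hT36 h3104 hkey hperm hcl hx hF hē hNC (hCq' q hq le_rfl).subset
    hirr hnt hpts hzcl hiso

end Unit

end BlowupTowerNearW

end Summit.ResolutionOfSingularities.ResolutionOfSingularities.Theorems.SigmaMaxModificationsCorridor3.Helpers

end
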